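import Literature.AlgebraicGeometry.Resolution.BlowupsProduct
import Literature.AlgebraicGeometry.Resolution.MarkedIdealsLemmas
import Literature.AlgebraicGeometry.Motives.CyclesPrincipalDivisorProofs
import Mathlib.RingTheory.Ideal.KrullsHeightTheorem
import Mathlib.RingTheory.Ideal.Height
import HarnessLib

/-!
# Lemmas for the divisorial part of an ideal sheaf (Cossart–Piltant 2008, proof of Prop. 4.2)

Topic: `Literature/AlgebraicGeometry/Resolution`. Commutative algebra and bookkeeping for the
decomposition `I = H · J` of a non-zero ideal sheaf on a regular scheme into its divisorial part
`H = 𝒪_X(-∑ a(i) E_i)` and a part `J = H⁻¹ I` with `V(J)` of codimension `≥ 2` ([CoP1] =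
Cossart–Piltant, J. Algebra 320 (2008), proof of Prop. 4.2, PDF p. 7; assembled in
`DivisorialPart.lean`), all PROVED:

* `Ideal.span_singleton_mul_colon_of_le` — `J ⊆ (h)` ⇒ `(h) · (J : h) = J` (so `H · (I : H) = I`
  for an invertible `H ⊇ I`);
* `Ideal.exists_eq_span_singleton_of_span_singleton_mul_eq` — in a domain, `(h) · J = (f)` with
  `h ≠ 0` forces `J` principal (cancellation: `I` locally principal ⇒ `J = H⁻¹ I` locally
  principal);
* `Finset.prod_pow_dvd_of_forall_pow_dvd` — for pairwise non-associated prime elements,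
  `(∀ i, q_i^{n_i} ∣ x) ⇒ ∏ q_i^{n_i} ∣ x` (so `⋂ (q_i^{n_i}) = (∏ q_i^{n_i})`: the stalks of
  `𝒪_X(-∑ a(i)E_i) = ∏ 𝓘_{E_i}^{a(i)}` contain `I`);
* `Ideal.exists_height_eq_one_of_mem_nonunits` — **Krull's principal ideal theorem, existence
  form**: a non-zero non-unit of a Noetherian domain lies in a height-one prime (Mathlib
  `Ideal.height_le_one_of_isPrincipal_of_mem_minimalPrimes`);
* `stalkIdeal_finset_prod` — stalks of finite products of ideal sheaves;
  `IsEffectiveCartier.finset_prod` — finite products of effective Cartier divisors;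
* `finite_setOf_mem_and_coheight_eq_one` — **on a Noetherian integral scheme, a proper closed
  subset contains only finitely many points of codimension one** (the `E_1, …, E_m` of [CoP1];
  Stacks 0BE1 — from the local finiteness proved in
  `Motives/CyclesPrincipalDivisorProofs.lean` and quasi-compactness);
* `eq_genericPoint_of_coheight_eq_zero`, `eq_of_specializes_of_coheight_le` — a specialisation
  that does not lower the (finite) codimension is trivial.

## Sources

* V. Cossart, O. Piltant, J. Algebra 320 (2008) 1051–1082, proof of Prop. 4.2 (PDF p. 7).
  [CossartPiltant2008]
* The Stacks Project, Tags 0BE1 (codimension-one points of a closed subset), 00KV (Krull's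
  Hauptidealsatz). [StacksProject]
-/

noncomputable section

open CategoryTheory CategoryTheory.Limits AlgebraicGeometry TopologicalSpace IsLocalRing

namespace Literature.AlgebraicGeometry.Resolution

universe u

/-! ## Ring lemmas -/

section Ring

variable {R : Type*} [CommRing R]

/-- **`J ⊆ (h)` ⇒ `(h) · (J : h) = J`.** [folklore] -/
theorem Ideal.span_singleton_mul_colon_of_le {J : Ideal R} {h : R} (hJ : J ≤ Ideal.span {h}) :
    Ideal.span {h} * Submodule.colon J (Ideal.span {h} : Set R) = J := by
  apply le_antisymm
  · rw [Ideal.mul_le]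
    intro a ha b hb
    obtain ⟨c, rfl⟩ := Ideal.mem_span_singleton'.mp ha
    have := (Submodule.mem_colon.mp hb) h (Ideal.mem_span_singleton_self h)
    rw [smul_eq_mul] at this
    rw [mul_assoc, mul_comm h b]
    exact J.mul_mem_left c this
  · intro f hf
    obtain ⟨g, rfl⟩ := Ideal.mem_span_singleton'.mp (hJ hf)
    rw [mul_comm g h]
    refine Ideal.mul_mem_mul (Ideal.mem_span_singleton_self h) (Submodule.mem_colon.mpr ?_)
    intro p hp
    obtain ⟨r, rfl⟩ := Ideal.mem_span_singleton'.mp hp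
    rw [smul_eq_mul, ← mul_assoc, mul_comm g r, mul_assoc]
    exact J.mul_mem_left r hf

/-- **Cancellation**: in a domain, if `(h) · J = (f)` with `h ≠ 0` then `J` is principal
(`f = h g` with `g ∈ J`, and `h y ∈ (h g)` gives `y ∈ (g)`). [folklore] -/
theorem Ideal.exists_eq_span_singleton_of_span_singleton_mul_eq [IsDomain R] {J : Ideal R}
    {f h : R} (hh : h ≠ 0) (e : Ideal.span {h} * J = Ideal.span {f}) :
    ∃ g ∈ J, J = Ideal.span {g} := by
  have hf : f ∈ Ideal.span {h} * J := e ▸ Ideal.mem_span_singleton_self f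
  obtain ⟨g, hg, rfl⟩ := Ideal.mem_span_singleton_mul.mp hf
  refine ⟨g, hg, le_antisymm (fun y hy => ?_) ((Ideal.span_singleton_le_iff_mem _).mpr hg)⟩
  have : h * y ∈ Ideal.span {h * g} :=
    e ▸ Ideal.mul_mem_mul (Ideal.mem_span_singleton_self h) hy
  obtain ⟨c, hc⟩ := Ideal.mem_span_singleton'.mp this
  refine Ideal.mem_span_singleton'.mpr ⟨c, mul_left_cancel₀ hh ?_⟩
  rw [← hc]
  ring

/-- **A product of powers of pairwise non-associated primes divides every common multiple of
the powers.** [folklore] -/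
theorem Finset.prod_pow_dvd_of_forall_pow_dvd [IsDomain R] {ι : Type*} (q : ι → R) (n : ι → ℕ)
    (s : Finset ι) (hq : ∀ i ∈ s, Prime (q i))
    (hna : ∀ i ∈ s, ∀ j ∈ s, i ≠ j → ¬ q i ∣ q j) {x : R} (hx : ∀ i ∈ s, q i ^ n i ∣ x) :
    (∏ i ∈ s, q i ^ n i) ∣ x := by
  classical
  induction s using Finset.induction_on generalizing x with
  | empty => simp
  | insert i s hi ih =>
    rw [Finset.prod_insert hi]
    obtain ⟨y, rfl⟩ := hx i (Finset.mem_insert_self i s)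
    refine mul_dvd_mul_left _ (ih (fun j hj => hq j (Finset.mem_insert_of_mem hj))
      (fun j hj k hk => hna j (Finset.mem_insert_of_mem hj) k (Finset.mem_insert_of_mem hk))
      fun j hj => ?_)
    -- `q_j^{n_j} ∣ q_i^{n_i} y` with `q_j ∤ q_i^{n_i}`
    have hji : j ≠ i := fun e => hi (e ▸ hj)
    refine (hq j (Finset.mem_insert_of_mem hj)).pow_dvd_of_dvd_mul_left (n j) ?_
      (hx j (Finset.mem_insert_of_mem hj))
    intro hdvd
    exact hna j (Finset.mem_insert_of_mem hj) i (Finset.mem_insert_self i s) hji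
      ((hq j (Finset.mem_insert_of_mem hj)).dvd_of_dvd_pow hdvd)

/-- **Krull's Hauptidealsatz, existence form**: a non-zero non-unit `g` of a Noetherian domain
lies in a prime ideal of height one (any minimal prime over `(g)`).
[cite: StacksProject, Tag 00KV] -/
theorem Ideal.exists_height_eq_one_of_mem_nonunits [IsDomain R] [IsNoetherianRing R] {g : R}
    (hg0 : g ≠ 0) (hg : ¬ IsUnit g) :
    ∃ P : Ideal R, P.IsPrime ∧ P.height = 1 ∧ g ∈ P := by
  have hne : Ideal.span {g} ≠ ⊤ := by
    rwa [Ne, Ideal.span_singleton_eq_top]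
  obtain ⟨M, hM, hgM⟩ := Ideal.exists_le_maximal _ hne
  obtain ⟨P, hPmin, hPM⟩ := Ideal.exists_minimalPrimes_le hgM
  haveI := hPmin.1.1
  refine ⟨P, hPmin.1.1, le_antisymm ?_ ?_, hPmin.1.2 (Ideal.mem_span_singleton_self g)⟩
  · exact Ideal.height_le_one_of_isPrincipal_of_mem_minimalPrimes _ P hPmin
  · rw [Order.one_le_iff_ne_zero, Ne, Ideal.height_eq_zero_iff_eq_bot]
    intro hP
    apply hg0
    have := hPmin.1.2 (Ideal.mem_span_singleton_self g)
    rwa [hP, Ideal.mem_bot] at this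

end Ring

/-! ## Stalks and effective Cartier divisors: finite products -/

section Products

variable {X : Scheme.{u}}

/-- Stalks of a finite product of ideal sheaves. [folklore] -/
theorem stalkIdeal_finset_prod {ι : Type*} (s : Finset ι) (K : ι → X.IdealSheafData) (x : X) :
    stalkIdeal (∏ i ∈ s, K i) x = ∏ i ∈ s, stalkIdeal (K i) x := by
  classical
  induction s using Finset.induction_on with
  | empty => rw [Finset.prod_empty, Finset.prod_empty, Scheme.IdealSheafData.one_eq_top,
      stalkIdeal_top, Ideal.one_eq_top]
  | insert i s hi ih => rw [Finset.prod_insert hi, Finset.prod_insert hi, stalkIdeal_mul, ih]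

/-- A finite product of effective Cartier divisors is an effective Cartier divisor. [folklore] -/
theorem IsEffectiveCartier.finset_prod {ι : Type*} (s : Finset ι) {K : ι → X.IdealSheafData}
    (hK : ∀ i ∈ s, IsEffectiveCartier (K i)) : IsEffectiveCartier (∏ i ∈ s, K i) := by
  classical
  induction s using Finset.induction_on with
  | empty =>
    rw [Finset.prod_empty, Scheme.IdealSheafData.one_eq_top]
    exact isEffectiveCartier_top
  | insert i s hi ih =>
    rw [Finset.prod_insert hi]
    exact (hK i (Finset.mem_insert_self i s)).mul
      (ih fun j hj => hK j (Finset.mem_insert_of_mem hj))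

end Products

/-! ## Codimension: generic point, trivial specialisations, finiteness of codimension-one points -/

section Codim

variable {X : Scheme.{u}}

/-- A point of codimension zero of an irreducible scheme is the generic point. [folklore] -/
theorem eq_genericPoint_of_coheight_eq_zero [IrreducibleSpace X] {x : X}
    (hx : Order.coheight x = 0) : x = genericPoint X := by
  rw [Order.coheight_eq_zero] at hx
  have h1 : x ≤ genericPoint X := (genericPoint_specializes x)
  have h2 : genericPoint X ≤ x := hx h1
  exact (Specializes.antisymm (Scheme.le_iff_specializes.mp h2)
    (Scheme.le_iff_specializes.mp h1)).eq

/-- **A specialisation `ζ ⤳ x` with `coheight ζ ≥ coheight x < ∞` is trivial.** [folklore] -/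
theorem eq_of_specializes_of_coheight_le {ζ x : X} (h : ζ ⤳ x) (hfin : Order.coheight x ≠ ⊤)
    (hle : Order.coheight x ≤ Order.coheight ζ) : ζ = x := by
  by_contra hne
  have hlt : x < ζ := lt_of_le_not_ge (Scheme.le_iff_specializes.mpr h) fun h' =>
    hne (Specializes.antisymm h (Scheme.le_iff_specializes.mp h')).eq
  have := Order.coheight_add_one_le hlt
  -- `coheight ζ + 1 ≤ coheight x ≤ coheight ζ < ⊤`
  have hζ : Order.coheight ζ ≠ ⊤ := fun e => hfin (top_le_iff.mp (by simpa [e] using this))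
  obtain ⟨c, hc⟩ := ENat.ne_top_iff_exists.mp hζ
  obtain ⟨d, hd⟩ := ENat.ne_top_iff_exists.mp hfin
  rw [← hc, ← hd] at this hle
  have h1 : c + 1 ≤ d := by exact_mod_cast this
  have h2 : d ≤ c := by exact_mod_cast hle
  omega

/-- Two distinct points of codimension one do not specialise to one another. [folklore] -/
theorem not_specializes_of_coheight_eq_one {ζ x : X} (hζ : Order.coheight ζ = 1)
    (hx : Order.coheight x = 1) (hne : ζ ≠ x) : ¬ ζ ⤳ x := fun h =>
  hne (eq_of_specializes_of_coheight_le h (by rw [hx]; exact ENat.coe_ne_top 1)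
    (by rw [hζ, hx]))

/-- **A proper closed subset of a Noetherian integral scheme contains only finitely many points
of codimension one** (Stacks 0BE1; the codimension-one components `E_1, …, E_m` of `V(I)` in
[CoP1], proof of Prop. 4.2): locally these are minimal primes of a non-zero ideal
(`Motives/CyclesPrincipalDivisorProofs.lean`), and `X` is quasi-compact.
[cite: StacksProject, Tag 0BE1] -/
theorem finite_setOf_mem_and_coheight_eq_one [IsIntegral X] [IsNoetherian X] {Z : Set X}
    (hZ : IsClosed Z) (hη : genericPoint X ∉ Z) : {x | x ∈ Z ∧ Order.coheight x = 1}.Finite := by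
  choose t ht hfin using
    fun y => Literature.AlgebraicGeometry.Motives.exists_nhds_finite_inter_coheight_eq_one hZ hη y
  obtain ⟨s, -, hs⟩ := isCompact_univ.elim_nhds_subcover (fun y => t y) fun y _ => ht y
  refine (s.finite_toSet.biUnion fun y _ => hfin y).subset ?_
  intro x hx
  obtain ⟨y, hy, hxy⟩ := Set.mem_iUnion₂.mp (hs (Set.mem_univ x))
  exact Set.mem_biUnion hy ⟨hxy, hx⟩

end Codim

end Literature.AlgebraicGeometry.Resolution

end
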